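/-
Copyright (c) 2026 the pub-hodgecm-mathlib formalisation cell (harness21).  Prover seat hodgecm-mathlib-LH4-p06 (g5), Track A «(D-RAM) FOUR-FRAME», unit U2H, census leaf
(ρ2b′-X) `stub_U2H_fixedPointCensus_typeTwo_unit0` — T5c «TORIC LEVEL CENSUS, M∕E-RAMIFIED»: the TOP CELLS of the depth-refined census (payer LH4-p14 (g4) MAP v2 seam
S6-RM, sheet v5 (D3) «diagonal sign cells») — THE COUNT, the RamM twin of LH4-p08 (g4)'s type-U ★ `F0P3cDyRamToricLevelCensusUnrTop` over ★ `…RamMTopPrep` (this seat),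
★ p857535 (g4's RamM depth rows) and ★ p857465 (the RamM norm-depth index).  2026-09-04.
-/
import Summits.HodgeConjecture.HodgeConjecture.Theorems.F0P3cDyRamToricLevelCensusRamMTopPrep  -- ★ (this seat): `dep_top_iff_ramified`, `v_one_add_twist_eq_of_top_ramified`, generator classes; brings ★ p857535 RamMDep, ★ HEAD p857549, ★ p857519 UnrTopPrep (type-free translation lemma)
import HarnessLib

/-!
# T5c: the TOP CELLS of the depth-refined level census `levelSetDep`, M∕E-RAMIFIED frame — the count (sheet v5 (D3): the diagonal sign cells)

Cell `hodgecm-mathlib` (D-0151), FLOOR 0, crux H413 = `stmt-HodgeConjecture-24833`; squad F0∕P3c∕LH4; lane `--supports stmt-HodgeConjecture-24833 --as helper` (count-neutral).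
THEOREMS ONLY (no `def`, no instance, no notation, no `sorry`, default heartbeats).  Socket served: payer MAP v2 seam S6-RM — «top cells (D3) open for p06's heir»: the one row
of the type-RamM table `#levelSetDep(j, a; μ)` that ★ p857535 (`levelSetDep_eq_of_generic_ramified`: off the coincidence diagonal ∕ under `GEN`) leaves open, namely the
COINCIDENCE DIAGONAL `j + m = jλ + a` with `e := 2a − m ≥ 1` (⟺ `¬GEN` there).

TOKENS (ramified frame, as in ★ p857535): `(M, ρ, α, d_ρ)` a ★ ramified quadratic datum, `Θ` an isometric involution commuting with `ρ`, `ϖE` `ρ`-fixed with `|ϖE| = exp(−2)`,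
`h ≠ 0`, `|h| = exp(−v_h)`; `|μ| = |ϖE|^m`, `|μ − ρμ| = |ϖE^{jλ}(α − ρα)|`; level `a`, tree level `j ≤ jλ`; level equation `v_h + d_ρ + 2k₀ + 2j = 2a` (generators `x₀ = α^{k₀}·ω`,
★ p857372); `η := (ρh∕h)·t(α^{k₀})` the class twist, `κ := ρμ∕μ`, `t(ω) = ρN(ω)∕N(ω)`, `N(ω) = ωΘω`.
THE MECHANISM (all ★, this file assembles; step for step LH4-p08 (g4)'s T5a top-cell argument in doubled tokens with `d_ρ` carried; the bookkeeping sentences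
`dep_top_iff_ramified` ∕ `v_one_add_twist_eq_of_top_ramified` ∕ `ncard_levelSetDep_eq_ncard_image_mk_ramified` are ★ `…RamMTopPrep`):
* §3 **(D3) THE TOP CELLS**: the passing generators are `α^{k₀}·ω₁·B_{s}` (`s := exp(2m − 2a − 2j − d_ρ)`, `B_s` the norm-depth subgroup) for ANY unit `ω₁` with
  `|1 + (η∕κ)·t(ω₁)| ≤ s` (★ approximate translation lemma), or none: **`ncard_levelSetDep_top_mul_eq_of_ramified`** `#levelSetDep(j,a;μ) · [U : B_s] = χ · q^j` with the bit
  `χ := [∃ ω₁ ∈ U_M, |1 + (η∕κ)·t(ω₁)| ≤ s]` (★ `[U : 𝒪_jˣ] = q^j` p857313, tower through `B_s`), the quotient form **`ncard_levelSetDep_top_eq_of_ramified`**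
  (`= χ · q^j ∕ [U : B_s]`), and the `¬GEN` packaging **`ncard_levelSetDep_eq_of_not_gen_ramified`** (on the diagonal `¬GEN ⟺ m < 2a`, using `a ≤ j` from the tokens) —
  sheet v5 (D3) `n_dep · I(c′) = q^j` or `0`, `c′ = j + a − m` (memo §6: 299∕299 alive cells, 106 dead = bit failures), with g32's `I(c′)` = `[U : B_s]`.
* §4 THE EXPLICIT KERNELS along the third field `K′ = K♮` (★ p857465, frame of ★ HEAD §4): **`ncard_levelSetDep_top_eq_explicit_even_of_ramified`** (K♮-level `2n`:
  `2(d′ + 2n) + 2m = 2j + 2a + d_ρ`, `[U : B_s] = if dΘ ≤ 2n+1 then q^n∕2 else q^n`) and **`…_odd_…`** (K♮-level `2n + 1`: `[U : B_s] = if dΘ ≤ 2n+2 then q^{n+1}∕2 else q^{n+1}`).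
* §5 (ED. 2, append-only) **`ncard_levelSetDep_top_eq_explicit_low_of_ramified`** — the low radius `|jK π′^n|`, `n ≤ d′`: `[U : B_s] = 1` (★ `relIndex_normDepth_eq_one_of_le`),
  `#levelSetDep = if χ then q^j else 0` (LH4-p04 (g4)'s `hvTop` row «`j + a < m + s0 ⇒ q^j`»).
HONEST LABEL.  Count-neutral (`--supports`); unconditional algebra over ★ organs; the census LAW (ρ2b′-X) is NOT asserted and the bit `χ` is left EXISTENTIAL (its closed form
is the separate sign law of the payer's O-Sign seam) — `HC_CM` is proved only modulo the 7 printed citations (2 remaining named inputs: hLiu418 = `stmt-HodgeConjecture-24832`,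
h413 = `stmt-HodgeConjecture-24833`) until rung 0 closes.

## References
* [Jacobowitz1962] R. Jacobowitz, *Hermitian forms over local fields*, Amer. J. Math. 84 (1962): §4 (duals, modular lattices, norm classes).
* [Serre1979] J.-P. Serre, *Local Fields*, GTM 67 (1979): Ch. IV §1 Prop. 3–4; Ch. V §1, §3 (norm subgroups, Cor. 3).
* [Kottwitz1986BaseChangeUnits] R. E. Kottwitz, *Base change for unit elements of Hecke algebras*, Compositio Math. 60 (1986): §1 pp. 240–241 (the tube ∕ depth condition).
* [Flicker1998UnitaryFL] Y. Z. Flicker, *Elementary proof of the fundamental lemma for a unitary group*, Canad. J. Math. 50 (1998): Prop. 7 p. 84 (Mars' unit indices).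
-/

set_option autoImplicit false

noncomputable section

namespace Summit.HodgeConjecture.HodgeConjecture.Cruxes.H413.F0P3cDyRamToricLevelCensusRamM

open WithZero
open scoped Pointwise Valued
open Literature.NumberTheory.Automorphic.UnitaryThreeFourFrame (IsRamifiedQuadraticDatum)
open Literature.NumberTheory.LocalFields.QuadraticOrder
open Summit.HodgeConjecture.HodgeConjecture.Cruxes.H413.F0P3cDyRamToricCensusDefs
open Summit.HodgeConjecture.HodgeConjecture.Cruxes.H413.F0P3cDyRamToricLevelCensusUnr (setOf_v_one_add_mul_twist_le_eq_smul_of_le)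

variable {K : Type} [Field K] [Valued K ℤᵐ⁰] {ρ Θ : K →+* K} {α ϖE h : K} {dρ t : ℕ}

/-! ## §3 (D3) The top cells: `#levelSetDep(j,a;μ) · [U : B_s] = χ · q^j` -/

open scoped Classical in
/-- **(D3) THE TOP CELLS OF THE RamM TABLE, INDEX FORM.**  On the coincidence diagonal `j + m = jλ + a` with `m < 2a` (`j ≤ jλ`; level equation `v_h + d_ρ + 2k₀ + 2j = 2a`),
with `U = {|u| = 1}`, `H = 𝒪_jˣ` and `B_s` the norm-depth subgroup at `s = exp(2m − 2a − 2j − d_ρ)`: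
**`#levelSetDep(j,a;μ) · [U : B_s] = (if χ then q^j else 0)`**, `χ := [∃ ω₁ ∈ U_M, |1 + (η∕κ)·t(ω₁)| ≤ s]`, `η = (ρh∕h)·t(α^{k₀})`, `κ = ρμ∕μ`
(the passing generators are `α^{k₀}·ω₁·B_s`, counted by `[B_s : 𝒪_jˣ] = q^j ∕ [U : B_s]`; sheet v5 (D3) `n_dep · I(c′) = q^j`, `c′ = j + a − m`).
[cite: Jacobowitz1962, §4] [cite: Serre1979, Ch. V §3] [cite: Flicker1998UnitaryFL, Prop. 7 p. 84] [cite: Kottwitz1986BaseChangeUnits, §1 pp. 240–241] -/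
theorem ncard_levelSetDep_top_mul_eq_of_ramified [IsDiscreteValuationRing 𝒪[K]] [Finite 𝓀[K]] (hD : IsRamifiedQuadraticDatum ρ α dρ t)
    (hΘΘ : ∀ x, Θ (Θ x) = x) (hΘρ : ∀ x, Θ (ρ x) = ρ (Θ x)) (hvΘ : ∀ x, Valued.v (Θ x) = Valued.v x)
    (hϖE : Valued.v ϖE = exp (-2 : ℤ)) (hρϖ : ρ ϖE = ϖE) {q : ℕ} (hq : Nat.card 𝓀[K] = q) (hh : h ≠ 0) {vh : ℤ} (hvh : Valued.v h = exp (-vh))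
    {μ : K} {m jl : ℕ} (hμ : Valued.v μ = Valued.v ϖE ^ m) (hjl : Valued.v (μ - ρ μ) = Valued.v (ϖE ^ jl * (α - ρ α)))
    {j a : ℕ} (hj : j ≤ jl) (hdiag : j + m = jl + a) (htop : m + 1 ≤ 2 * a) {k₀ : ℤ} (hk₀ : vh + dρ + 2 * k₀ + 2 * j = 2 * a)
    (U H B : Subgroup Kˣ) (hU : ∀ u : Kˣ, u ∈ U ↔ Valued.v (u : K) = 1)
    (hH : ∀ u : Kˣ, u ∈ H ↔ Valued.v (u : K) = 1 ∧ Valued.v ((u : K) - ρ u) ≤ Valued.v (ϖE ^ j * (α - ρ α)))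
    (hB : ∀ ω : Kˣ, ω ∈ B ↔ Valued.v (ω : K) = 1 ∧ Valued.v ((ω : K) * Θ ω - ρ ((ω : K) * Θ ω)) ≤ exp (2 * (m : ℤ) - 2 * a - 2 * j - dρ)) :
    (levelSetDep ρ Θ α ϖE h j a μ).ncard * B.relIndex U =
      if ∃ ω₁ : Kˣ, Valued.v (ω₁ : K) = 1 ∧
          Valued.v (1 + ρ h / h * (ρ (α ^ k₀ * Θ (α ^ k₀)) / (α ^ k₀ * Θ (α ^ k₀))) / (ρ μ / μ) * (ρ ((ω₁ : K) * Θ ω₁) / ((ω₁ : K) * Θ ω₁))) ≤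
            exp (2 * (m : ℤ) - 2 * a - 2 * j - dρ)
      then q ^ j else 0 := by
  -- adapted from LH4-p08 (g4)'s type-U `ncard_levelSetDep_top_hyper` (★ F0P3cDyRamToricLevelCensusUnrTop), generator normal form `x₀ = α^{k₀}·ω` (★ p857372)
  classical
  obtain ⟨hρρ, hvρ, hα, hfix, -, -, -⟩ := id hD
  have hρα := map_ne_self_of_datum hD
  have hδ := v_sub_map_eq_exp_of_datum hD
  obtain ⟨hα0, -⟩ := ne_zero_and_v_zpow_of_v_eq hα 0
  have hmjl := le_of_mu_tokens_ramified hD hρϖ hϖE hμ hjl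
  have ha : 1 ≤ a := by omega
  have ham : a ≤ m := by omega
  have haj : a ≤ j := by omega
  have hma : m < j + a := by omega
  have he : m < 2 * a := by omega
  -- (1) `#levelSetDep` as generator classes mod `H = 𝒪_jˣ`
  rw [ncard_levelSetDep_eq_ncard_image_mk_ramified hD hΘΘ hΘρ hvΘ hρϖ hϖE hh hμ j a hH]
  -- (2) the passing generators are `g • {ω ∈ U_M : |1 + (η∕κ)·t(ω)| ≤ s}`, `g = α^{k₀}`
  set g : Kˣ := Units.mk0 α hα0 ^ k₀ with hg
  have hGen := setOf_levelGenR_eq_smul_of_pos (Θ := Θ) hρρ hvΘ hfix hρα hα hδ hϖE hρϖ hα0 hh hvh j ha hk₀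
  have hgcoe : ∀ ω : Kˣ, ((g • ω : Kˣ) : K) = α ^ k₀ * ω := fun ω => by
    rw [smul_eq_mul, Units.val_mul, hg, Units.val_zpow_eq_zpow_val, Units.val_mk0]
  have hPQ : {x₀ : Kˣ |
        (((Valued.v (h * ((x₀ : K) * Θ x₀) * (ϖE ^ j * (α - ρ α))) ≤ 1 ∧
              Valued.v (h * ((x₀ : K) * Θ x₀) * (ϖE ^ j * (α - ρ α)) - ρ (h * ((x₀ : K) * Θ x₀) * (ϖE ^ j * (α - ρ α)))) ≤ Valued.v (ϖE ^ j * (α - ρ α))) ∧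
            ¬ (Valued.v (h * ((x₀ : K) * Θ x₀) * (ϖE ^ j * (α - ρ α)) / ϖE) ≤ 1 ∧
                Valued.v (h * ((x₀ : K) * Θ x₀) * (ϖE ^ j * (α - ρ α)) / ϖE - ρ (h * ((x₀ : K) * Θ x₀) * (ϖE ^ j * (α - ρ α)) / ϖE)) ≤
                  Valued.v (ϖE ^ j * (α - ρ α)))) ∧
          Valued.v (h * ((x₀ : K) * Θ x₀) * (ϖE ^ j * (α - ρ α))) = Valued.v ϖE ^ a) ∧
        (a ≤ m ∧ (j + a ≤ m ∨
          Valued.v (μ / (h * ((x₀ : K) * Θ x₀) * (ϖE ^ j * (α - ρ α)) * ϖE ^ (m - a)) -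
              ρ (μ / (h * ((x₀ : K) * Θ x₀) * (ϖE ^ j * (α - ρ α)) * ϖE ^ (m - a)))) ≤ exp (2 * (m : ℤ) - 2 * a - 2 * j - dρ)))} =
      g • {ω : Kˣ | Valued.v (ω : K) = 1 ∧
        Valued.v (1 + ρ h / h * (ρ (α ^ k₀ * Θ (α ^ k₀)) / (α ^ k₀ * Θ (α ^ k₀))) / (ρ μ / μ) * (ρ ((ω : K) * Θ ω) / ((ω : K) * Θ ω))) ≤
          exp (2 * (m : ℤ) - 2 * a - 2 * j - dρ)} := by
    ext x₀
    rw [Set.mem_smul_set_iff_inv_smul_mem, Set.mem_setOf_eq, Set.mem_setOf_eq]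
    have hx : x₀ = g • (g⁻¹ • x₀) := (smul_inv_smul g x₀).symm
    have hxcoe : (x₀ : K) = α ^ k₀ * ((g⁻¹ • x₀ : Kˣ) : K) := by
      conv_lhs => rw [hx]
      exact hgcoe _
    -- the twist splits off the class factor `t(α^{k₀})` (★ `normTwist_mul`)
    have htw : ρ ((x₀ : K) * Θ x₀) / ((x₀ : K) * Θ x₀) =
        ρ (α ^ k₀ * Θ (α ^ k₀)) / (α ^ k₀ * Θ (α ^ k₀)) *
          (ρ (((g⁻¹ • x₀ : Kˣ) : K) * Θ ((g⁻¹ • x₀ : Kˣ) : K)) / (((g⁻¹ • x₀ : Kˣ) : K) * Θ ((g⁻¹ • x₀ : Kˣ) : K))) := by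
      rw [hxcoe]; exact normTwist_mul (zpow_ne_zero k₀ hα0) (g⁻¹ • x₀).ne_zero
    have hassoc : ρ h / h / (ρ μ / μ) * (ρ (α ^ k₀ * Θ (α ^ k₀)) / (α ^ k₀ * Θ (α ^ k₀)) *
          (ρ (((g⁻¹ • x₀ : Kˣ) : K) * Θ ((g⁻¹ • x₀ : Kˣ) : K)) / (((g⁻¹ • x₀ : Kˣ) : K) * Θ ((g⁻¹ • x₀ : Kˣ) : K)))) =
        ρ h / h * (ρ (α ^ k₀ * Θ (α ^ k₀)) / (α ^ k₀ * Θ (α ^ k₀))) / (ρ μ / μ) *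
          (ρ (((g⁻¹ • x₀ : Kˣ) : K) * Θ ((g⁻¹ • x₀ : Kˣ) : K)) / (((g⁻¹ • x₀ : Kˣ) : K) * Θ ((g⁻¹ • x₀ : Kˣ) : K))) := by ring
    constructor
    · rintro ⟨hP, hQ⟩
      have hmem : x₀ ∈ g • {ω : Kˣ | Valued.v (ω : K) = 1 ∧
          Valued.v (1 + (ρ h / h * (ρ (α ^ k₀ * Θ (α ^ k₀)) / (α ^ k₀ * Θ (α ^ k₀)))) * (ρ ((ω : K) * Θ ω) / ((ω : K) * Θ ω))) =
            exp (2 * (a : ℤ) - 2 * j - dρ)} := by rw [← hGen]; exact hP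
      rw [Set.mem_smul_set_iff_inv_smul_mem, Set.mem_setOf_eq] at hmem
      refine ⟨hmem.1, ?_⟩
      have hQ' := (dep_top_iff_ramified (Θ := Θ) hD hρϖ hϖE hh hμ hjl ham hma x₀.ne_zero hP.2).1 hQ
      rw [htw, hassoc] at hQ'
      exact hQ'
    · rintro ⟨hω1, hωtop⟩
      have hlevel : Valued.v (1 + (ρ h / h * (ρ (α ^ k₀ * Θ (α ^ k₀)) / (α ^ k₀ * Θ (α ^ k₀)))) *
          (ρ (((g⁻¹ • x₀ : Kˣ) : K) * Θ ((g⁻¹ • x₀ : Kˣ) : K)) / (((g⁻¹ • x₀ : Kˣ) : K) * Θ ((g⁻¹ • x₀ : Kˣ) : K)))) =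
            exp (2 * (a : ℤ) - 2 * j - dρ) :=
        v_one_add_twist_eq_of_top_ramified hD hϖE hμ hjl hdiag he hωtop
      have hP : x₀ ∈ {x₀ : Kˣ |
          ((Valued.v (h * ((x₀ : K) * Θ x₀) * (ϖE ^ j * (α - ρ α))) ≤ 1 ∧
                Valued.v (h * ((x₀ : K) * Θ x₀) * (ϖE ^ j * (α - ρ α)) - ρ (h * ((x₀ : K) * Θ x₀) * (ϖE ^ j * (α - ρ α)))) ≤ Valued.v (ϖE ^ j * (α - ρ α))) ∧
              ¬ (Valued.v (h * ((x₀ : K) * Θ x₀) * (ϖE ^ j * (α - ρ α)) / ϖE) ≤ 1 ∧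
                  Valued.v (h * ((x₀ : K) * Θ x₀) * (ϖE ^ j * (α - ρ α)) / ϖE - ρ (h * ((x₀ : K) * Θ x₀) * (ϖE ^ j * (α - ρ α)) / ϖE)) ≤
                    Valued.v (ϖE ^ j * (α - ρ α)))) ∧
            Valued.v (h * ((x₀ : K) * Θ x₀) * (ϖE ^ j * (α - ρ α))) = Valued.v ϖE ^ a} := by
        rw [hGen, Set.mem_smul_set_iff_inv_smul_mem, Set.mem_setOf_eq]
        exact ⟨hω1, hlevel⟩
      rw [Set.mem_setOf_eq] at hP
      refine ⟨hP, ?_⟩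
      refine (dep_top_iff_ramified (Θ := Θ) hD hρϖ hϖE hh hμ hjl ham hma x₀.ne_zero hP.2).2 ?_
      rw [htw, hassoc]
      exact hωtop
  rw [hPQ, ncard_image_mk_smul]
  by_cases hχ : ∃ ω₁ : Kˣ, Valued.v (ω₁ : K) = 1 ∧
      Valued.v (1 + ρ h / h * (ρ (α ^ k₀ * Θ (α ^ k₀)) / (α ^ k₀ * Θ (α ^ k₀))) / (ρ μ / μ) * (ρ ((ω₁ : K) * Θ ω₁) / ((ω₁ : K) * Θ ω₁))) ≤
        exp (2 * (m : ℤ) - 2 * a - 2 * j - dρ)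
  · obtain ⟨ω₁, hω₁, hω₁top⟩ := hχ
    rw [if_pos ⟨ω₁, hω₁, hω₁top⟩, setOf_v_one_add_mul_twist_le_eq_smul_of_le hvρ hvΘ hω₁ hω₁top hB, ncard_image_mk_smul_subgroup H B ω₁]
    -- `[B_s : 𝒪_jˣ]·[U : B_s] = [U : 𝒪_jˣ] = q^j`
    have hHB : H ≤ B :=
      orderUnits_le_normDepth hvρ hΘρ hvΘ (by rw [v_conductorR (ρ := ρ) hδ hϖE j, exp_le_exp]; omega) hH hB
    have hBU : B ≤ U := fun ω hω => (hU ω).2 ((hB ω).1 hω).1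
    rw [Subgroup.relIndex_mul_relIndex H B U hHB hBU]
    exact relIndex_orderUnits_eq_of_isRamifiedQuadraticDatum hD hϖE hq j U H hU hH
  · rw [if_neg hχ]
    have hempty : {ω : Kˣ | Valued.v (ω : K) = 1 ∧
        Valued.v (1 + ρ h / h * (ρ (α ^ k₀ * Θ (α ^ k₀)) / (α ^ k₀ * Θ (α ^ k₀))) / (ρ μ / μ) * (ρ ((ω : K) * Θ ω) / ((ω : K) * Θ ω))) ≤
          exp (2 * (m : ℤ) - 2 * a - 2 * j - dρ)} = ∅ :=
      Set.eq_empty_of_forall_notMem (fun ω hω => hχ ⟨ω, hω.1, hω.2⟩)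
    rw [hempty, Set.image_empty, Set.ncard_empty, zero_mul]

open scoped Classical in
/-- **(D3) THE TOP CELLS, QUOTIENT FORM**: `#levelSetDep(j,a;μ) = if χ then q^j ∕ [U : B_s] else 0` (exact division: `[B_s : 𝒪_jˣ]·[U : B_s] = q^j`, ★ p857313).
[cite: Jacobowitz1962, §4] [cite: Serre1979, Ch. V §3] [cite: Flicker1998UnitaryFL, Prop. 7 p. 84] -/
theorem ncard_levelSetDep_top_eq_of_ramified [IsDiscreteValuationRing 𝒪[K]] [Finite 𝓀[K]] (hD : IsRamifiedQuadraticDatum ρ α dρ t)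
    (hΘΘ : ∀ x, Θ (Θ x) = x) (hΘρ : ∀ x, Θ (ρ x) = ρ (Θ x)) (hvΘ : ∀ x, Valued.v (Θ x) = Valued.v x)
    (hϖE : Valued.v ϖE = exp (-2 : ℤ)) (hρϖ : ρ ϖE = ϖE) {q : ℕ} (hq : Nat.card 𝓀[K] = q) (hh : h ≠ 0) {vh : ℤ} (hvh : Valued.v h = exp (-vh))
    {μ : K} {m jl : ℕ} (hμ : Valued.v μ = Valued.v ϖE ^ m) (hjl : Valued.v (μ - ρ μ) = Valued.v (ϖE ^ jl * (α - ρ α)))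
    {j a : ℕ} (hj : j ≤ jl) (hdiag : j + m = jl + a) (htop : m + 1 ≤ 2 * a) {k₀ : ℤ} (hk₀ : vh + dρ + 2 * k₀ + 2 * j = 2 * a)
    (U H B : Subgroup Kˣ) (hU : ∀ u : Kˣ, u ∈ U ↔ Valued.v (u : K) = 1)
    (hH : ∀ u : Kˣ, u ∈ H ↔ Valued.v (u : K) = 1 ∧ Valued.v ((u : K) - ρ u) ≤ Valued.v (ϖE ^ j * (α - ρ α)))
    (hB : ∀ ω : Kˣ, ω ∈ B ↔ Valued.v (ω : K) = 1 ∧ Valued.v ((ω : K) * Θ ω - ρ ((ω : K) * Θ ω)) ≤ exp (2 * (m : ℤ) - 2 * a - 2 * j - dρ)) :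
    (levelSetDep ρ Θ α ϖE h j a μ).ncard =
      if ∃ ω₁ : Kˣ, Valued.v (ω₁ : K) = 1 ∧
          Valued.v (1 + ρ h / h * (ρ (α ^ k₀ * Θ (α ^ k₀)) / (α ^ k₀ * Θ (α ^ k₀))) / (ρ μ / μ) * (ρ ((ω₁ : K) * Θ ω₁) / ((ω₁ : K) * Θ ω₁))) ≤
            exp (2 * (m : ℤ) - 2 * a - 2 * j - dρ)
      then q ^ j / B.relIndex U else 0 := by
  classical
  obtain ⟨-, hvρ, -, -, -, -, -⟩ := id hD
  have hmjl := le_of_mu_tokens_ramified hD hρϖ hϖE hμ hjl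
  have hmul := ncard_levelSetDep_top_mul_eq_of_ramified hD hΘΘ hΘρ hvΘ hϖE hρϖ hq hh hvh hμ hjl hj hdiag htop hk₀ U H B hU hH hB
  have hHB : H ≤ B :=
    orderUnits_le_normDepth hvρ hΘρ hvΘ (by rw [v_conductorR (ρ := ρ) (v_sub_map_eq_exp_of_datum hD) hϖE j, exp_le_exp]; omega) hH hB
  have hBU : B ≤ U := fun ω hω => (hU ω).2 ((hB ω).1 hω).1
  have htower : H.relIndex B * B.relIndex U = q ^ j := by
    rw [Subgroup.relIndex_mul_relIndex H B U hHB hBU]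
    exact relIndex_orderUnits_eq_of_isRamifiedQuadraticDatum hD hϖE hq j U H hU hH
  have hBU0 : B.relIndex U ≠ 0 := fun h0 => pow_ne_zero j (card_residueField_ne_zero hq) (by rw [← htower, h0, mul_zero])
  by_cases hχ : ∃ ω₁ : Kˣ, Valued.v (ω₁ : K) = 1 ∧
      Valued.v (1 + ρ h / h * (ρ (α ^ k₀ * Θ (α ^ k₀)) / (α ^ k₀ * Θ (α ^ k₀))) / (ρ μ / μ) * (ρ ((ω₁ : K) * Θ ω₁) / ((ω₁ : K) * Θ ω₁))) ≤
        exp (2 * (m : ℤ) - 2 * a - 2 * j - dρ)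
  · rw [if_pos hχ] at hmul ⊢
    exact Nat.eq_div_of_mul_eq_left hBU0 hmul
  · rw [if_neg hχ] at hmul ⊢
    exact (mul_eq_zero.1 hmul).resolve_right hBU0

open scoped Classical in
/-- **(D3) PACKAGED AGAINST ★ p857535: THE `¬GEN` ROW ON THE DIAGONAL.**  On the coincidence diagonal `j + m = jλ + a` (`j ≤ jλ`), the complement of the generic rule
`GEN := a ≤ m ∧ (j ≤ m − a ∨ (2a ≤ m ∧ j + a ≤ jλ))` is exactly the top half `m < 2a` (occupied levels have `a ≤ j`, §1), and there
`#levelSetDep(j,a;μ) = if χ then q^j ∕ [U : B_s] else 0` — so ★ `levelSetDep_eq_of_generic_ramified` + ★ `(R1-A0)` + this row exhaust the type-RamM table for `j ≤ jλ`.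
[cite: Jacobowitz1962, §4] [cite: Kottwitz1986BaseChangeUnits, §1 pp. 240–241] [cite: Flicker1998UnitaryFL, Prop. 7 p. 84] -/
theorem ncard_levelSetDep_eq_of_not_gen_ramified [IsDiscreteValuationRing 𝒪[K]] [Finite 𝓀[K]] (hD : IsRamifiedQuadraticDatum ρ α dρ t)
    (hΘΘ : ∀ x, Θ (Θ x) = x) (hΘρ : ∀ x, Θ (ρ x) = ρ (Θ x)) (hvΘ : ∀ x, Valued.v (Θ x) = Valued.v x)
    (hϖE : Valued.v ϖE = exp (-2 : ℤ)) (hρϖ : ρ ϖE = ϖE) {q : ℕ} (hq : Nat.card 𝓀[K] = q) (hh : h ≠ 0) {vh : ℤ} (hvh : Valued.v h = exp (-vh))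
    {μ : K} {m jl : ℕ} (hμ : Valued.v μ = Valued.v ϖE ^ m) (hjl : Valued.v (μ - ρ μ) = Valued.v (ϖE ^ jl * (α - ρ α)))
    {j a : ℕ} (hj : j ≤ jl) (hdiag : j + m = jl + a) (hng : ¬ (a ≤ m ∧ (j ≤ m - a ∨ (2 * a ≤ m ∧ j + a ≤ jl))))
    {k₀ : ℤ} (hk₀ : vh + dρ + 2 * k₀ + 2 * j = 2 * a)
    (U H B : Subgroup Kˣ) (hU : ∀ u : Kˣ, u ∈ U ↔ Valued.v (u : K) = 1)
    (hH : ∀ u : Kˣ, u ∈ H ↔ Valued.v (u : K) = 1 ∧ Valued.v ((u : K) - ρ u) ≤ Valued.v (ϖE ^ j * (α - ρ α)))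
    (hB : ∀ ω : Kˣ, ω ∈ B ↔ Valued.v (ω : K) = 1 ∧ Valued.v ((ω : K) * Θ ω - ρ ((ω : K) * Θ ω)) ≤ exp (2 * (m : ℤ) - 2 * a - 2 * j - dρ)) :
    (levelSetDep ρ Θ α ϖE h j a μ).ncard =
      if ∃ ω₁ : Kˣ, Valued.v (ω₁ : K) = 1 ∧
          Valued.v (1 + ρ h / h * (ρ (α ^ k₀ * Θ (α ^ k₀)) / (α ^ k₀ * Θ (α ^ k₀))) / (ρ μ / μ) * (ρ ((ω₁ : K) * Θ ω₁) / ((ω₁ : K) * Θ ω₁))) ≤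
            exp (2 * (m : ℤ) - 2 * a - 2 * j - dρ)
      then q ^ j / B.relIndex U else 0 := by
  have hmjl := le_of_mu_tokens_ramified hD hρϖ hϖE hμ hjl
  have htop : m + 1 ≤ 2 * a := by
    by_contra hlt
    exact hng ⟨by omega, Or.inr ⟨by omega, by omega⟩⟩
  exact ncard_levelSetDep_top_eq_of_ramified hD hΘΘ hΘρ hvΘ hϖE hρϖ hq hh hvh hμ hjl hj hdiag htop hk₀ U H B hU hH hB

/-! ## §4 The explicit kernels along the third field `K′ = K♮` (★ p857465) -/

open scoped Classical in
/-- **(D3) THE TOP CELLS EXPLICIT, `B_s` AT EVEN K♮-LEVEL `2n`** (`2(d′ + 2n) + 2m = 2j + 2a + d_ρ`): in the third-field frame of ★ HEAD §4 (ramified datum `(σ′, π′, d′)` on `K′`,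
`#𝓀[K′] = q`, order-compatible `jK : K′ →+* M` onto the `Θ`-fixed elements, `jK∘σ′ = ρ∘jK`, `|jK π′| = exp(−2)`, `Θ`-datum `(M, Θ, ϖ, dΘ, tΘ)`, base-unit token `hFN`):
**`#levelSetDep(j,a;μ) = if χ then q^j ∕ I(2n) else 0`**, `I(2n) = if dΘ ≤ 2n+1 then q^n∕2 else q^n` (★ `relIndex_normDepth_eq_ite_pow_of_ramified`).
[cite: Serre1979, Ch. V §3 Cor. 3] [cite: Flicker1998UnitaryFL, Prop. 7 p. 84] [cite: Jacobowitz1962, §4] -/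
theorem ncard_levelSetDep_top_eq_explicit_even_of_ramified [CompleteSpace K] [IsDiscreteValuationRing 𝒪[K]] [Finite 𝓀[K]]
    {K' : Type*} [Field K'] [Valued K' ℤᵐ⁰] [IsDiscreteValuationRing 𝒪[K']] [Finite 𝓀[K']] {σ' : K' →+* K'} {π' : K'} {d' : ℕ}
    (hD : IsRamifiedQuadraticDatum ρ α dρ t) (hΘρ : ∀ x, Θ (ρ x) = ρ (Θ x)) (hvΘ : ∀ x, Valued.v (Θ x) = Valued.v x)
    (hϖE : Valued.v ϖE = exp (-2 : ℤ)) (hρϖ : ρ ϖE = ϖE) {q : ℕ} (hq : Nat.card 𝓀[K] = q) (hq' : Nat.card 𝓀[K'] = q)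
    (hσ' : ∀ x, σ' (σ' x) = x) (hvσ' : ∀ x, Valued.v (σ' x) = Valued.v x) (hfix' : ∀ x : K', σ' x = x → x ≠ 0 → ∃ n : ℤ, Valued.v x = exp (2 * n))
    (hπ' : Valued.v π' = exp (-1 : ℤ)) (hdd' : Valued.v (π' - σ' π') = Valued.v π' ^ d')
    (jK : K' →+* K) (hjle : ∀ x y : K', Valued.v (jK x) ≤ Valued.v (jK y) ↔ Valued.v x ≤ Valued.v y) (hjΘ : ∀ x, Θ (jK x) = jK x)
    (hjfix : ∀ z : K, Θ z = z → ∃ x, jK x = z) (hjσ : ∀ x, jK (σ' x) = ρ (jK x)) (hjπ : Valued.v (jK π') = exp (-2 : ℤ))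
    {ϖ : K} {dΘ tΘ : ℕ} (hDΘ : IsRamifiedQuadraticDatum Θ ϖ dΘ tΘ)
    (hFN : ∀ f : K, ρ f = f → Θ f = f → Valued.v f = 1 → ∃ x : K, x * Θ x = f)
    (hh : h ≠ 0) {vh : ℤ} (hvh : Valued.v h = exp (-vh))
    {μ : K} {m jl : ℕ} (hμ : Valued.v μ = Valued.v ϖE ^ m) (hjl : Valued.v (μ - ρ μ) = Valued.v (ϖE ^ jl * (α - ρ α)))
    {j a : ℕ} (hj : j ≤ jl) (hdiag : j + m = jl + a) (htop : m + 1 ≤ 2 * a) {k₀ : ℤ} (hk₀ : vh + dρ + 2 * k₀ + 2 * j = 2 * a)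
    {n : ℕ} (hn : 2 * ((d' : ℤ) + 2 * n) + 2 * m = 2 * j + 2 * a + dρ)
    (U H B : Subgroup Kˣ) (hU : ∀ u : Kˣ, u ∈ U ↔ Valued.v (u : K) = 1)
    (hH : ∀ u : Kˣ, u ∈ H ↔ Valued.v (u : K) = 1 ∧ Valued.v ((u : K) - ρ u) ≤ Valued.v (ϖE ^ j * (α - ρ α)))
    (hB : ∀ ω : Kˣ, ω ∈ B ↔ Valued.v (ω : K) = 1 ∧ Valued.v ((ω : K) * Θ ω - ρ ((ω : K) * Θ ω)) ≤ exp (2 * (m : ℤ) - 2 * a - 2 * j - dρ)) :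
    (levelSetDep ρ Θ α ϖE h j a μ).ncard =
      if ∃ ω₁ : Kˣ, Valued.v (ω₁ : K) = 1 ∧
          Valued.v (1 + ρ h / h * (ρ (α ^ k₀ * Θ (α ^ k₀)) / (α ^ k₀ * Θ (α ^ k₀))) / (ρ μ / μ) * (ρ ((ω₁ : K) * Θ ω₁) / ((ω₁ : K) * Θ ω₁))) ≤
            exp (2 * (m : ℤ) - 2 * a - 2 * j - dρ)
      then q ^ j / (if dΘ ≤ 2 * n + 1 then q ^ n / 2 else q ^ n) else 0 := by
  have hΘΘ := hDΘ.1
  obtain ⟨Ut, hUt⟩ := exists_subgroup_thetaFixed_units (K := K) (Θ := Θ)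
  obtain ⟨Vt, hVt⟩ := exists_subgroup_thetaFixed_depth (Θ := Θ) hD.2.1 (Valued.v (jK π' ^ (d' + 2 * n)))
  have hBj : ∀ ω : Kˣ, ω ∈ B ↔ Valued.v (ω : K) = 1 ∧ Valued.v ((ω : K) * Θ ω - ρ ((ω : K) * Θ ω)) ≤ Valued.v (jK π' ^ (d' + 2 * n)) := by
    intro ω
    rw [hB, v_map_pow_eq_exp_neg_two_mul jK hjπ, show (2 * (m : ℤ) - 2 * a - 2 * j - dρ) = -(2 * ((d' + 2 * n : ℕ) : ℤ)) by push_cast; omega]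
  rw [ncard_levelSetDep_top_eq_of_ramified hD hΘΘ hΘρ hvΘ hϖE hρϖ hq hh hvh hμ hjl hj hdiag htop hk₀ U H B hU hH hB,
    relIndex_normDepth_eq_ite_pow_of_ramified hσ' hvσ' hfix' hπ' hdd' hq' jK hjle hjΘ hjfix hjσ hjπ hDΘ hFN n U Ut Vt B hU hUt hVt hBj]

open scoped Classical in
/-- **(D3) THE TOP CELLS EXPLICIT, `B_s` AT ODD K♮-LEVEL `2n + 1`** (`2(d′ + 2n + 1) + 2m = 2j + 2a + d_ρ`): **`#levelSetDep(j,a;μ) = if χ then q^j ∕ I(2n+1) else 0`**,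
`I(2n+1) = if dΘ ≤ 2n+2 then q^{n+1}∕2 else q^{n+1}` (★ `relIndex_normDepth_odd_eq_ite_pow_of_ramified`).
[cite: Serre1979, Ch. V §3 Cor. 3] [cite: Flicker1998UnitaryFL, Prop. 7 p. 84] [cite: Jacobowitz1962, §4] -/
theorem ncard_levelSetDep_top_eq_explicit_odd_of_ramified [CompleteSpace K] [IsDiscreteValuationRing 𝒪[K]] [Finite 𝓀[K]]
    {K' : Type*} [Field K'] [Valued K' ℤᵐ⁰] [IsDiscreteValuationRing 𝒪[K']] [Finite 𝓀[K']] {σ' : K' →+* K'} {π' : K'} {d' : ℕ}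
    (hD : IsRamifiedQuadraticDatum ρ α dρ t) (hΘρ : ∀ x, Θ (ρ x) = ρ (Θ x)) (hvΘ : ∀ x, Valued.v (Θ x) = Valued.v x)
    (hϖE : Valued.v ϖE = exp (-2 : ℤ)) (hρϖ : ρ ϖE = ϖE) {q : ℕ} (hq : Nat.card 𝓀[K] = q) (hq' : Nat.card 𝓀[K'] = q)
    (hσ' : ∀ x, σ' (σ' x) = x) (hvσ' : ∀ x, Valued.v (σ' x) = Valued.v x) (hfix' : ∀ x : K', σ' x = x → x ≠ 0 → ∃ n : ℤ, Valued.v x = exp (2 * n))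
    (hπ' : Valued.v π' = exp (-1 : ℤ)) (hdd' : Valued.v (π' - σ' π') = Valued.v π' ^ d')
    (jK : K' →+* K) (hjle : ∀ x y : K', Valued.v (jK x) ≤ Valued.v (jK y) ↔ Valued.v x ≤ Valued.v y) (hjΘ : ∀ x, Θ (jK x) = jK x)
    (hjfix : ∀ z : K, Θ z = z → ∃ x, jK x = z) (hjσ : ∀ x, jK (σ' x) = ρ (jK x)) (hjπ : Valued.v (jK π') = exp (-2 : ℤ))
    {ϖ : K} {dΘ tΘ : ℕ} (hDΘ : IsRamifiedQuadraticDatum Θ ϖ dΘ tΘ)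
    (hFN : ∀ f : K, ρ f = f → Θ f = f → Valued.v f = 1 → ∃ x : K, x * Θ x = f)
    (hh : h ≠ 0) {vh : ℤ} (hvh : Valued.v h = exp (-vh))
    {μ : K} {m jl : ℕ} (hμ : Valued.v μ = Valued.v ϖE ^ m) (hjl : Valued.v (μ - ρ μ) = Valued.v (ϖE ^ jl * (α - ρ α)))
    {j a : ℕ} (hj : j ≤ jl) (hdiag : j + m = jl + a) (htop : m + 1 ≤ 2 * a) {k₀ : ℤ} (hk₀ : vh + dρ + 2 * k₀ + 2 * j = 2 * a)
    {n : ℕ} (hn : 2 * ((d' : ℤ) + 2 * n + 1) + 2 * m = 2 * j + 2 * a + dρ)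
    (U H B : Subgroup Kˣ) (hU : ∀ u : Kˣ, u ∈ U ↔ Valued.v (u : K) = 1)
    (hH : ∀ u : Kˣ, u ∈ H ↔ Valued.v (u : K) = 1 ∧ Valued.v ((u : K) - ρ u) ≤ Valued.v (ϖE ^ j * (α - ρ α)))
    (hB : ∀ ω : Kˣ, ω ∈ B ↔ Valued.v (ω : K) = 1 ∧ Valued.v ((ω : K) * Θ ω - ρ ((ω : K) * Θ ω)) ≤ exp (2 * (m : ℤ) - 2 * a - 2 * j - dρ)) :
    (levelSetDep ρ Θ α ϖE h j a μ).ncard =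
      if ∃ ω₁ : Kˣ, Valued.v (ω₁ : K) = 1 ∧
          Valued.v (1 + ρ h / h * (ρ (α ^ k₀ * Θ (α ^ k₀)) / (α ^ k₀ * Θ (α ^ k₀))) / (ρ μ / μ) * (ρ ((ω₁ : K) * Θ ω₁) / ((ω₁ : K) * Θ ω₁))) ≤
            exp (2 * (m : ℤ) - 2 * a - 2 * j - dρ)
      then q ^ j / (if dΘ ≤ 2 * n + 2 then q ^ (n + 1) / 2 else q ^ (n + 1)) else 0 := by
  have hΘΘ := hDΘ.1
  obtain ⟨Ut, hUt⟩ := exists_subgroup_thetaFixed_units (K := K) (Θ := Θ)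
  obtain ⟨Vt, hVt⟩ := exists_subgroup_thetaFixed_depth (Θ := Θ) hD.2.1 (Valued.v (jK π' ^ (d' + (2 * n + 1))))
  have hBj : ∀ ω : Kˣ, ω ∈ B ↔ Valued.v (ω : K) = 1 ∧ Valued.v ((ω : K) * Θ ω - ρ ((ω : K) * Θ ω)) ≤ Valued.v (jK π' ^ (d' + (2 * n + 1))) := by
    intro ω
    rw [hB, v_map_pow_eq_exp_neg_two_mul jK hjπ, show (2 * (m : ℤ) - 2 * a - 2 * j - dρ) = -(2 * ((d' + (2 * n + 1) : ℕ) : ℤ)) by push_cast; omega]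
  rw [ncard_levelSetDep_top_eq_of_ramified hD hΘΘ hΘρ hvΘ hϖE hρϖ hq hh hvh hμ hjl hj hdiag htop hk₀ U H B hU hH hB,
    relIndex_normDepth_odd_eq_ite_pow_of_ramified hσ' hvσ' hfix' hπ' hdd' hq' jK hjle hjΘ hjfix hjσ hjπ hDΘ hFN n U Ut Vt B hU hUt hVt hBj]

/-! ## §5 (ED. 2) The low radius: `[U : B_s] = 1` -/

open scoped Classical in
/-- **(D3) THE TOP CELLS EXPLICIT AT LOW RADIUS (`[U : B_s] = 1`)**: if `B_s` sits at `M`-depth `|jK π′^n|` with `n ≤ d′` (`2n + 2m = 2j + 2a + d_ρ`), every unit of `M` lies in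
`B_s` (★ `relIndex_normDepth_eq_one_of_le`: the different bound `|z′ − σ′z′| ≤ |π′|^{d′}` on the third field), so **`#levelSetDep(j,a;μ) = if χ then q^j else 0`** —
LH4-p04 (g4)'s T5s-RamM `hvTop` row «`j + a < m + s0 ⇒ q^j`» (only the order-compatible `jK`, `σ′`-datum letters and `Θ` involutive are needed here; no `Θ`-datum, no
completeness). [cite: Serre1979, Ch. IV §1 Prop. 3–4] [cite: Flicker1998UnitaryFL, Prop. 7 p. 84] [cite: Jacobowitz1962, §4] -/
theorem ncard_levelSetDep_top_eq_explicit_low_of_ramified [IsDiscreteValuationRing 𝒪[K]] [Finite 𝓀[K]]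
    {K' : Type*} [Field K'] [Valued K' ℤᵐ⁰] {σ' : K' →+* K'} {π' : K'} {d' : ℕ}
    (hD : IsRamifiedQuadraticDatum ρ α dρ t) (hΘΘ : ∀ x, Θ (Θ x) = x) (hΘρ : ∀ x, Θ (ρ x) = ρ (Θ x)) (hvΘ : ∀ x, Valued.v (Θ x) = Valued.v x)
    (hϖE : Valued.v ϖE = exp (-2 : ℤ)) (hρϖ : ρ ϖE = ϖE) {q : ℕ} (hq : Nat.card 𝓀[K] = q)
    (hσ' : ∀ x, σ' (σ' x) = x) (hfix' : ∀ x : K', σ' x = x → x ≠ 0 → ∃ n : ℤ, Valued.v x = exp (2 * n))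
    (hπ' : Valued.v π' = exp (-1 : ℤ)) (hdd' : Valued.v (π' - σ' π') = Valued.v π' ^ d')
    (jK : K' →+* K) (hjle : ∀ x y : K', Valued.v (jK x) ≤ Valued.v (jK y) ↔ Valued.v x ≤ Valued.v y)
    (hjfix : ∀ z : K, Θ z = z → ∃ x, jK x = z) (hjσ : ∀ x, jK (σ' x) = ρ (jK x)) (hjπ : Valued.v (jK π') = exp (-2 : ℤ))
    (hh : h ≠ 0) {vh : ℤ} (hvh : Valued.v h = exp (-vh))
    {μ : K} {m jl : ℕ} (hμ : Valued.v μ = Valued.v ϖE ^ m) (hjl : Valued.v (μ - ρ μ) = Valued.v (ϖE ^ jl * (α - ρ α)))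
    {j a : ℕ} (hj : j ≤ jl) (hdiag : j + m = jl + a) (htop : m + 1 ≤ 2 * a) {k₀ : ℤ} (hk₀ : vh + dρ + 2 * k₀ + 2 * j = 2 * a)
    {n : ℕ} (hn : 2 * (n : ℤ) + 2 * m = 2 * j + 2 * a + dρ) (hnd : n ≤ d')
    (U H B : Subgroup Kˣ) (hU : ∀ u : Kˣ, u ∈ U ↔ Valued.v (u : K) = 1)
    (hH : ∀ u : Kˣ, u ∈ H ↔ Valued.v (u : K) = 1 ∧ Valued.v ((u : K) - ρ u) ≤ Valued.v (ϖE ^ j * (α - ρ α)))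
    (hB : ∀ ω : Kˣ, ω ∈ B ↔ Valued.v (ω : K) = 1 ∧ Valued.v ((ω : K) * Θ ω - ρ ((ω : K) * Θ ω)) ≤ exp (2 * (m : ℤ) - 2 * a - 2 * j - dρ)) :
    (levelSetDep ρ Θ α ϖE h j a μ).ncard =
      if ∃ ω₁ : Kˣ, Valued.v (ω₁ : K) = 1 ∧
          Valued.v (1 + ρ h / h * (ρ (α ^ k₀ * Θ (α ^ k₀)) / (α ^ k₀ * Θ (α ^ k₀))) / (ρ μ / μ) * (ρ ((ω₁ : K) * Θ ω₁) / ((ω₁ : K) * Θ ω₁))) ≤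
            exp (2 * (m : ℤ) - 2 * a - 2 * j - dρ)
      then q ^ j else 0 := by
  have hBj : ∀ ω : Kˣ, ω ∈ B ↔ Valued.v (ω : K) = 1 ∧ Valued.v ((ω : K) * Θ ω - ρ ((ω : K) * Θ ω)) ≤ Valued.v (jK π' ^ n) := by
    intro ω
    rw [hB, v_map_pow_eq_exp_neg_two_mul jK hjπ, show (2 * (m : ℤ) - 2 * a - 2 * j - dρ) = -(2 * (n : ℤ)) by omega]
  rw [ncard_levelSetDep_top_eq_of_ramified hD hΘΘ hΘρ hvΘ hϖE hρϖ hq hh hvh hμ hjl hj hdiag htop hk₀ U H B hU hH hB,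
    relIndex_normDepth_eq_one_of_le hσ' hfix' hπ' hdd' jK hjle hjfix hjσ hΘΘ hvΘ hnd U B hU hBj, Nat.div_one]

end Summit.HodgeConjecture.HodgeConjecture.Cruxes.H413.F0P3cDyRamToricLevelCensusRamM

end
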